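import Summits.ValiantsHypothesis.ValiantsHypothesis.Theorems.KPlusLogSqLawTropicalBThinLogCycles
import Summits.ValiantsHypothesis.ValiantsHypothesis.Theorems.KPlusLogSqLawTropicalBSignsFree

/-!
# Route «KPlusLogSqLaw», crux `TropicalB` (stmt-ValiantsHypothesis-19771) — THE THIN STUB ⟺ FEW SUPER-LOGARITHMIC EXCHANGE CYCLES

HONEST FRAMING.  Helper toward the registered stub `stub_tropThin` of `Cruxes/TropicalB/Lines/birth.lean` (crux
`Summit.ValiantsHypothesis.ValiantsHypothesis.Theses.KPlusLogSqLaw.TropicalB`, item stmt-ValiantsHypothesis-19771, route KPlusLogSqLaw; cell `pub-symmetroid`, seat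
val-sym-trop-p1 g25, 2026-08-29; `--supports … --as helper`).  A REFORMULATION (kernel iff) of the thin stub's STATEMENT — written out here as the proposition
`∃ C, ∀ m K, K ≤ ⌊log₂ m⌋² → TropRootLawAt m K (2^(C·⌊log₂ m⌋²))` (`TropRow` of birth.lean is `TropicalCensus.TropRootLawAt` by `Iff.rfl`); nothing is asserted
about it or about `TropicalB`, and nothing bears on `WeakLifting`, DoorA26 / DoorA34, `MatrixDescartes` (stmt-ValiantsHypothesis-18050) or VP ≠ VNP.

* `eq_zero_of_no_classes` — with `K = 0` classes a chain with distinct consecutive terms has `n = 0` (a class map `Fin m → Fin 0` forces `m = 0`).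
* **`thinStub_iff_fewLongCycles`** — the thin stub holds iff there is `C` such that, whenever `K ≤ ⌊log₂ m⌋²`, every UNSIGNED dominant chain of every design
  of format `(m, K)` has at most `2^(C·⌊log₂ m⌋²)` steps whose exchange quotient `σ_k⁻¹σ_{k+1}` has an orbit of MORE THAN `⌊log₂ m⌋` columns (formally: not
  every column lies in an invariant set of `≤ ⌊log₂ m⌋` columns).  (→): such steps are steps, and the stub bounds unsigned chains up to the factor `2` of
  `tropRowD_of_tropRootLawAt` (…SignsFree).  (←): the log-cycle sector theorem `LocalPattern.chain_le_thin_logCycles_of_exceptions`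
  (`n ≤ #J + 2^(8⌊log₂ m⌋²)`, this seat) and `2^(CL²) + 2^(8L²) ≤ 2^((C+9)L²)`.
So in the thin window the registered stub is EXACTLY a budget for super-logarithmic exchange cycles.
[this cell's law]
-/

set_option linter.dupNamespace false
set_option autoImplicit false

namespace Summit.ValiantsHypothesis.ValiantsHypothesis.Theorems.KPlusLogSqLaw

open Summit.ValiantsHypothesis.ValiantsHypothesis.Theorems.MatrixDescartes.Negative
open Summit.ValiantsHypothesis.ValiantsHypothesis.Theorems.LacunarySymmetroidMatrixDescartes.TropicalCensus (TropRootLawAt)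
open scoped BigOperators
open Finset

namespace LocalPattern

/-- with no classes, a chain with distinct consecutive terms is a single term. [folklore] -/
theorem eq_zero_of_no_classes {m n : ℕ} (p : Fin (n + 1) → Equiv.Perm (Fin m) × (Fin m → Fin 0))
    (hne : ∀ k : Fin n, p k.castSucc ≠ p k.succ) : n = 0 := by
  rcases Nat.eq_zero_or_pos m with hm | hm
  · rcases Nat.eq_zero_or_pos n with h | h
    · exact h
    · exfalso
      exact hne ⟨0, h⟩ (Prod.ext (Equiv.ext fun b => absurd b.isLt (by omega)) (funext fun b => absurd b.isLt (by omega)))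
  · exact absurd ((p 0).2 ⟨0, hm⟩).isLt (Nat.not_lt_zero _)

/-- **The thin stub ⟺ few super-logarithmic exchange cycles.** [this cell's law] -/
theorem thinStub_iff_fewLongCycles :
    (∃ C : ℕ, ∀ m K : ℕ, K ≤ Nat.log 2 m ^ 2 → TropRootLawAt m K (2 ^ (C * Nat.log 2 m ^ 2))) ↔
    ∃ C : ℕ, ∀ (m K : ℕ), K ≤ Nat.log 2 m ^ 2 → ∀ (d : Fin K → ℕ) (v ε : Fin m → Fin m → Fin K → ℤ) (n : ℕ) (θ : Fin (n + 1) → ℤ)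
      (p : Fin (n + 1) → Equiv.Perm (Fin m) × (Fin m → Fin K)),
      StrictMono θ → (∀ k, IsDominant d v ε (θ k) (p k)) → (∀ k : Fin n, p k.castSucc ≠ p k.succ) →
      (univ.filter fun k : Fin n => ¬ ∀ b : Fin m, ∃ T : Finset (Fin m), b ∈ T ∧ T.card ≤ Nat.log 2 m ∧
        ∀ x, ((p k.castSucc).1⁻¹ * (p k.succ).1) x ∈ T ↔ x ∈ T).card ≤ 2 ^ (C * Nat.log 2 m ^ 2) := by
  classical
  constructor
  · rintro ⟨C, hC⟩
    refine ⟨C + 1, fun m K hK d v ε n θ p hθ hdom hne => ?_⟩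
    have hn : n ≤ 2 * 2 ^ (C * Nat.log 2 m ^ 2) := tropRowD_of_tropRootLawAt (hC m K hK) d v ε n θ p hθ hdom hne
    have hcard : (univ.filter fun k : Fin n => ¬ ∀ b : Fin m, ∃ T : Finset (Fin m), b ∈ T ∧ T.card ≤ Nat.log 2 m ∧
        ∀ x, ((p k.castSucc).1⁻¹ * (p k.succ).1) x ∈ T ↔ x ∈ T).card ≤ n :=
      (card_le_univ _).trans (by rw [Fintype.card_fin])
    rcases Nat.eq_zero_or_pos (Nat.log 2 m) with hL | hL
    · -- no classes: `n = 0`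
      rw [hL] at hK
      have hK0 : K = 0 := by omega
      subst hK0
      have hn0 := eq_zero_of_no_classes p hne
      subst hn0
      exact hcard.trans (Nat.zero_le _)
    · refine hcard.trans (hn.trans ?_)
      calc 2 * 2 ^ (C * Nat.log 2 m ^ 2) = 2 ^ (C * Nat.log 2 m ^ 2 + 1) := by rw [pow_succ]; ring
        _ ≤ 2 ^ ((C + 1) * Nat.log 2 m ^ 2) := Nat.pow_le_pow_right (by norm_num) (by nlinarith)
  · rintro ⟨C, hC⟩
    refine ⟨C + 9, fun m K hK d v ε n θ p _ hθ hdom halt => ?_⟩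
    have hne : ∀ k : Fin n, p k.castSucc ≠ p k.succ := ne_succ_of_alternating ε p halt
    set J : Finset (Fin n) := univ.filter fun k : Fin n => ¬ ∀ b : Fin m, ∃ T : Finset (Fin m), b ∈ T ∧ T.card ≤ Nat.log 2 m ∧
        ∀ x, ((p k.castSucc).1⁻¹ * (p k.succ).1) x ∈ T ↔ x ∈ T with hJ
    have hJC : J.card ≤ 2 ^ (C * Nat.log 2 m ^ 2) := hC m K hK d v ε n θ p hθ hdom hne
    have horb : ∀ k : Fin n, k ∉ J → ∀ b : Fin m, ∃ T : Finset (Fin m), b ∈ T ∧ T.card ≤ Nat.log 2 m ∧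
        ∀ x, ((p k.castSucc).1⁻¹ * (p k.succ).1) x ∈ T ↔ x ∈ T := by
      intro k hk
      by_contra h
      exact hk (mem_filter.mpr ⟨mem_univ _, h⟩)
    have hlaw := chain_le_thin_logCycles_of_exceptions d v ε hK θ p hθ hdom hne J horb
    rcases Nat.eq_zero_or_pos (Nat.log 2 m) with hL | hL
    · rw [hL] at hK
      have hK0 : K = 0 := by omega
      subst hK0
      have hn0 := eq_zero_of_no_classes p hne
      calc n = 0 := hn0
        _ ≤ _ := Nat.zero_le _
    · set X := Nat.log 2 m ^ 2 with hX
      have hX1 : 1 ≤ X := by rw [hX]; nlinarith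
      have h1 : 2 ^ (C * X) ≤ 2 ^ ((C + 8) * X) := Nat.pow_le_pow_right (by norm_num) (by nlinarith)
      have h2 : 2 ^ (8 * X) ≤ 2 ^ ((C + 8) * X) := Nat.pow_le_pow_right (by norm_num) (by nlinarith)
      have h3 : 2 ^ ((C + 8) * X) + 2 ^ ((C + 8) * X) = 2 ^ ((C + 8) * X + 1) := by rw [pow_succ]; ring
      have h4 : 2 ^ ((C + 8) * X + 1) ≤ 2 ^ ((C + 9) * X) := Nat.pow_le_pow_right (by norm_num) (by nlinarith)
      omega

end LocalPattern

end Summit.ValiantsHypothesis.ValiantsHypothesis.Theorems.KPlusLogSqLaw
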